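import Summits.QuantumFields.BalabanUV.Gaps.BetaContFromD4Chain
import Summits.QuantumFields.YangMills.Theses.BalabanUVNodes
import Literature.MathematicalPhysics.QuantumFieldTheory.Balaban1983to89.T4BetaStationary

/-!
# DAG node N26 — binder B4 «β-continuity» `∃ γc > 0, FlowStep.BetaContH γc D.βfun` AT A DATUM, knit BY NAME from the
# (D4)-chain fold (`Gaps.BetaContFromD4Chain`, p342809 ∕ p343785) and from its other tree roads; where it sits inside the
# detail route's item `Theses.BalabanUVNodes.EndpointGivenB` (stmt-QuantumFields-19181)

Cell `pub-ymgap`, YM-PLAN Track A (HUMAN RULING D-0062), seat `pub-ymgap-dag-n26-a` (-a = KNIT-BY-NAME).  Node of record N26 =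
YM-PLAN v0.12.15 §2d row B4 (venue `HOME/lean/ym-dag/N26_B4.lean`: `YMDAG.B4lit D := ∃ γc : ℝ, 0 < γc ∧ FlowStep.BetaContH γc D.βfun`;
dagwriter supply `YMDAG.UVSplit.N26_B4lit Rec`, an aside in no join).  STATUS OF RECORD: DEPENDENT on row (D4); VACATED in the
discharge form of record (`T4ContinuumYM4Torus.continuumYM4_torus_of_endpointExistence` does not take it) — it closes WITH B3 = N25
(endpoint existence, NODE O).  This file is the node's glue BY NAME, in the honest shape asked for by the discharge referee dag-ref-D
(pub-ymgap INBOX l.8905 (1)) and the director (LINE №13, l.8918): the (D4) objects for a one-loop split OF THE DATUM'S OWN β-FAMILY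
`D.βfun` — ONE inhabitant `R : ChainTFac190H 4 M μ ν Sβ γ₀ c ℓ α₂ q`, its numeric side conditions `CondsL ∕ R22gen ∕ Consts190.Valid ∕
SignsL`, the termwise history-continuity clause `CPt R` ([I] p. 264, the sentence after (1.22)) and `0 < γ₀` — are DECLARED
HYPOTHESES; the conclusion is N26's literal for THAT datum.  `BetaContH γ β` is vacuous for `γ ≤ 0` (empty box), whence the
explicit `0 < γ₀` (= N28's γ-half).

WHAT IS HERE (all proofs are compositions of tree theorems BY NAME; no definition, no restatement, 0 `sorry`):
* §0 `betaContH_of_le`, `n26lit_iff_smallBoxes`, `betaPertHyp_iff` — B4 restricts to smaller boxes; N26's literal ⇔ continuity on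
  all small boxes; N26's literal IS the second conjunct of the tree's literal β-package `T4Continuum.BetaPertHyp D.βfun` (B3 ∧ B4).
* §1 N26 AT A DATUM `D : T4Continuum.FiniteEpsData F G` (any gauge group; the venue's `YMDAG.Datum F N` is `G = SU(N)`):
  `n26_of_chainTFac190H` ∕ `_dim` ∕ `n26_of_chainTFac190` ((D4) chain + side conditions + `CPt` + `0 < γ₀`, holomorphic ∕ analytic
  currency, d = 4 ∕ any d ≥ 1) · `n26_of_atSlopeCont` (the packaged residue `Gaps.BetaContFromD4Chain.AtSlopeCont` of rows (D4) ∧ B4)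
  · `n26_members_of_objectsFamilyCont` (family level: every member of Bałaban's ε₁-scheme with small activity; the datum's β-family is
  deliberately NOT pinned to a member by an equation here) · `n26_of_histLipschitz` (independently, from spine node U2 ∕ N22's Lipschitz-in-history currency,
  `T4BetaStationary.betaContH_of_histLipschitz`) · `n26_at_record` (the record-predicate shape of the UVSplit supply, any `Rec`).
* §2 WHERE N26 SITS IN ITEM 19181: `endpoint_and_n26_of_residue_atSlopeCont` ∕ `…_of_D1Drift_atSlopeCont` — at a datum, the β-side
  package of record ((D1) residue or drift, the split pinned to the step kernels, `AtSlopeCont Sβ γ₀ (stepBal N Lc)`, `0 < γ₀`) gives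
  `EndpointExistence D.C.toB12` (N25) AND N26's literal AND `0 < γ₀` from the SAME hypotheses (`D.fwd` supplies forward generation) —
  «B4 ∕ B6 close with B3» in kernel form; `endpointGivenB_of_betaSide` — the item `Theses.BalabanUVNodes.EndpointGivenB` from that
  package assumed at every Stage-0 datum of record carrying (B) (declared hypothesis; NODE O's instance is 0∕1);
  `endpointGivenB_of_betaPertHyp` — the same through the LITERAL binders B3 ∧ B4 (`T4Continuum.endpointExistence_of_betaPertHyp`; the
  tree flags `BetaPertH` RIGID, `BetaPertRigid`, so this road is recorded, not recommended).
* §3 `continuumYM4Torus_of_BetaPertH_chain` — the LITERAL T⁴ headline (`continuumYM4_torus_of_BetaPertH_nonvacuous`, where B4 is NOT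
  vacated) with its B4 binder supplied by the (D4) chain + `CPt`; B1, B2, B3, B5 stay binders.
* §4 `hypotheses_satisfiable_placeholder` — the hypothesis LIST of §1–§2 is consistent AT a Stage-0 datum of record: the tree's
  placeholder datum (`T4FiniteEpsInhabited.stubData` on NODE 00's averaging of record; β-family ≡ 0, zero remainder chain).  HONESTY
  LABEL: this is the WRONG β for Bałaban — (B) is FALSE there (`not_endStatementBPrinted_of_stubData`) — a satisfiability check of the
  typed hypotheses (referee audit A1–A6), NOT an instance; the instance count for Bałaban's split stays 0∕1.
* §5 (v1.1, appended; dag-ref-D READ #7 question A3) `oneLoopSplit_β0_eq` … `betaSidePackage_unsat_flat` — at the FLAT β-family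
  the §2 package is UNSATISFIABLE (`Lc ≥ 2`), so the ∀-form item glue is true-but-vacuous at Stage 0; `endpoint_conclusion_of_exists_
  betaSide` ∕ `endpointGivenB_of_exists_betaSide` — the ∃-form (ONE datum of record per family WITH its package ⟹ the conclusion).

HONEST FRAMING.  Bookkeeping by name; nothing of Bałaban's series is asserted beyond print; no estimate is proved here; N26 is a
shadow of NODE O's β-side and is discharged only WITH N25 at the datum of record D₀ (NODE 00 Stage 5, none yet).  One finite
four-torus programme at fixed ε; NOT the continuum limit on ℝ⁴, NOT infinite volume, NOT OS axioms, NOT a mass gap, NOT Clay.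
Sources (context only): [I] = Balaban1987RG1 (CMP 109) Thm 2 p. 259, (1.20)–(1.22) p. 264, (5.10) p. 293; [II] = Balaban1988RG2Cluster
(CMP 116) Lemma 3 (2.38) p. 20.
-/

noncomputable section

namespace Summit.QuantumFields.YangMills.Theorems.BalabanUVNodesN26

open Literature.MathematicalPhysics.QuantumFieldTheory.Balaban1983to89
open Literature.MathematicalPhysics.QuantumFieldTheory.Balaban1983to89.FlowStep
open Literature.MathematicalPhysics.QuantumFieldTheory.Balaban1983to89.DagBinding
open Literature.MathematicalPhysics.QuantumFieldTheory.Balaban1983to89.T4Continuum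
open Literature.MathematicalPhysics.QuantumFieldTheory.Balaban1983to89.T4ContinuumYM4Torus
open Literature.MathematicalPhysics.QuantumFieldTheory.Balaban1983to89.Beta.RemainderChainLattice
open Literature.MathematicalPhysics.QuantumFieldTheory.Balaban1983to89.Beta.RemainderLimitTorus (LDom limKernel)
open Literature.MathematicalPhysics.QuantumFieldTheory.Balaban1983to89.Beta.RemainderDecay190
open Literature.MathematicalPhysics.QuantumFieldTheory.Balaban1983to89.Beta.RemainderDecay190HoloChain
open Literature.MathematicalPhysics.QuantumFieldTheory.Balaban1983to89.Beta.RemainderResidueFamily (ObjectsFamily)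
open Literature.MathematicalPhysics.QuantumFieldTheory.Balaban1983to89.Beta.RemainderWitness
  (c₀ q₀ zeroLeaves190 c₀_condsL c₀_R22gen c₀_activity_pos q₀_valid_c₀)
open Literature.MathematicalPhysics.QuantumFieldTheory.Balaban1983to89.Beta.OneStepKernelFamily (D1Drift TbalOf)
open Literature.MathematicalPhysics.QuantumFieldTheory.Balaban1983to89.Beta.OneStepResolventKernel (JetData)
open Summit.QuantumFields.BalabanUV.Gaps
open Summit.QuantumFields.BalabanUV.Gaps.BetaContFromD4Chain

/-! ## §0 The literal, its box restriction, and its place in the tree's literal β-package -/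

/-- B4 on the box `]0,γ]` restricts to every smaller box `]0,γ']`, `γ' ≤ γ` (`FlowStep.box_mono`). -/
theorem betaContH_of_le {β : HBeta} {γ γ' : ℝ} (h : BetaContH γ β) (hle : γ' ≤ γ) : BetaContH γ' β :=
  fun k => (h k).mono (box_mono hle k)

/-- N26's literal `∃ γc > 0, BetaContH γc β` ⇔ joint continuity on ALL sufficiently small boxes — the form every flow consumer
restricts to (`FlowStepRuns`, `hcont'` lines). -/
theorem n26lit_iff_smallBoxes {β : HBeta} :
    (∃ γc : ℝ, 0 < γc ∧ BetaContH γc β) ↔ ∃ γc : ℝ, 0 < γc ∧ ∀ γ : ℝ, 0 < γ → γ ≤ γc → BetaContH γ β :=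
  ⟨fun ⟨γc, hγc, h⟩ => ⟨γc, hγc, fun _ _ hle => betaContH_of_le h hle⟩, fun ⟨γc, hγc, h⟩ => ⟨γc, hγc, h γc hγc le_rfl⟩⟩

/-- N26's literal IS the second conjunct of the literal β-package `T4Continuum.BetaPertHyp β` of the T⁴ headline (B3-literal ∧
B4-literal), by `Iff.rfl` — the one tree name under which the node's statement already occurs. -/
theorem betaPertHyp_iff {β : HBeta} :
    BetaPertHyp β ↔ (∃ βbar : ℝ, 0 < βbar ∧ BetaPertH β βbar) ∧ ∃ γc : ℝ, 0 < γc ∧ BetaContH γc β :=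
  Iff.rfl

/-! ## §1 N26 AT A DATUM from the (D4) chain (+ side conditions + `CPt` + `0 < γ₀`), and from the other tree roads -/

section Datum

variable {F : T4Family} {G : Type*} [GaugeGroup G] [MeasurableSpace G] [HaarData G]

/-- **N26 AT A DATUM ⇐ ONE (D4)-CHAIN INSTANCE FOR THE DATUM'S β-FAMILY + (C-pt) + `0 < γ₀`** (d = 4, holomorphic currency; the
honest glue shape of dag-ref-D l.8905 (1)): a one-loop split `Sβ` OF `D.βfun`, one inhabitant `R : ChainTFac190H 4 M μ ν Sβ γ₀ c ℓ α₂ q`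
([II] Lemma 3 (2.38) leaves, (190), (1.7) — hypothesis fields), N1 `CondsL`, the closing relation `R22gen`, N2 `Consts190.Valid` ∕
`SignsL`, the termwise clause `CPt R` ([I] p. 264 after (1.22)) and `0 < γ₀` ⟹ `∃ γc > 0, BetaContH γc D.βfun`, with `γc := γ₀` —
`Gaps.BetaContFromD4Chain.betaContH_of_chainTFac190H` BY NAME.  Every hypothesis declared; no instance for Bałaban's split exists in
the tree (0∕1). -/
theorem n26_of_chainTFac190H (D : FiniteEpsData F G) {M : ℕ} [NeZero M] {μ ν : Fin 4}
    (Sβ : B12Beta.OneLoopSplit D.βfun) {γ₀ : ℝ} (hγ₀ : 0 < γ₀) {c : B13.Consts} {ℓ α₂ : ℝ} {q : Consts190}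
    (R : ChainTFac190H 4 M μ ν Sβ γ₀ c ℓ α₂ q) (hC : CondsL 4 c ℓ) (h22 : c.R22gen ℓ) (hq : q.Valid c.δ₀)
    (hs : SignsL c α₂ q.B₃) (hcont : CPt R) : ∃ γc : ℝ, 0 < γc ∧ BetaContH γc D.βfun :=
  ⟨γ₀, hγ₀, betaContH_of_chainTFac190H R hC h22 hq hs (by norm_num) hcont⟩

/-- The same in ANY dimension `d ≥ 1` (the fold is dimension-generic; the node of record is `d = 4`). -/
theorem n26_of_chainTFac190H_dim (D : FiniteEpsData F G) {d M : ℕ} [NeZero M] (hd : 0 < d) {μ ν : Fin d}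
    (Sβ : B12Beta.OneLoopSplit D.βfun) {γ₀ : ℝ} (hγ₀ : 0 < γ₀) {c : B13.Consts} {ℓ α₂ : ℝ} {q : Consts190}
    (R : ChainTFac190H d M μ ν Sβ γ₀ c ℓ α₂ q) (hC : CondsL d c ℓ) (h22 : c.R22gen ℓ) (hq : q.Valid c.δ₀)
    (hs : SignsL c α₂ q.B₃) (hcont : CPt R) : ∃ γc : ℝ, 0 < γc ∧ BetaContH γc D.βfun :=
  ⟨γ₀, hγ₀, betaContH_of_chainTFac190H R hC h22 hq hs hd hcont⟩

/-- ANALYTIC-currency socket (`RemainderDecay190.ChainTFac190`, through `ChainTFac190H.ofAnalytic`). -/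
theorem n26_of_chainTFac190 (D : FiniteEpsData F G) {M : ℕ} [NeZero M] {μ ν : Fin 4}
    (Sβ : B12Beta.OneLoopSplit D.βfun) {γ₀ : ℝ} (hγ₀ : 0 < γ₀) {c : B13.Consts} {ℓ α₂ : ℝ} {q : Consts190}
    (R : ChainTFac190 4 M μ ν Sβ γ₀ c ℓ α₂ q) (hC : CondsL 4 c ℓ) (h22 : c.R22gen ℓ) (hq : q.Valid c.δ₀)
    (hs : SignsL c α₂ q.B₃) (hcont : CPt (ChainTFac190H.ofAnalytic R)) : ∃ γc : ℝ, 0 < γc ∧ BetaContH γc D.βfun :=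
  ⟨γ₀, hγ₀, betaContH_of_chainTFac190 R hC h22 hq hs (by norm_num) hcont⟩

/-- **N26 AT A DATUM ⇐ the packaged residue of rows (D4) ∧ B4** `AtSlopeCont Sβ γ₀ s` (one chain + side conditions + smallness +
`CPt`, d = 4) on a box `γ₀ > 0` — `betaContH_of_atSlopeCont` BY NAME. -/
theorem n26_of_atSlopeCont (D : FiniteEpsData F G) (Sβ : B12Beta.OneLoopSplit D.βfun) {γ₀ s : ℝ} (hγ₀ : 0 < γ₀)
    (hres : AtSlopeCont Sβ γ₀ s) : ∃ γc : ℝ, 0 < γc ∧ BetaContH γc D.βfun :=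
  ⟨γ₀, hγ₀, betaContH_of_atSlopeCont hres⟩

/-- **FAMILY LEVEL**: if Bałaban's ε₁-scheme carries the object residue with the clause (`ObjectsFamilyCont βf Sf`: one [II]-record and
(190)-record, and for every activity `e ∈ ]0, ε₁]` a box and a chain with `CPt`), then EVERY member with small activity satisfies B4's
literal: `∃ c₁ > 0, ∀ e ∈ ]0, c₁], ∃ γc > 0, BetaContH γc (βf e)` (`atSlopeCont_member_of_objectsFamilyCont` at `s := e·K`). -/
theorem n26_members_of_objectsFamilyCont {βf : ℝ → HBeta} {Sf : (e : ℝ) → B12Beta.OneLoopSplit (βf e)}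
    (h : ObjectsFamilyCont βf Sf) :
    ∃ c₁ : ℝ, 0 < c₁ ∧ ∀ e : ℝ, 0 < e → e ≤ c₁ → ∃ γc : ℝ, 0 < γc ∧ BetaContH γc (βf e) := by
  obtain ⟨K, c₁, hc₁, hall⟩ := atSlopeCont_member_of_objectsFamilyCont h
  refine ⟨c₁, hc₁, fun e he hle => ?_⟩
  obtain ⟨γ₀, hγ₀, hres⟩ := hall e he hle (e * K) le_rfl
  exact ⟨γ₀, hγ₀, betaContH_of_atSlopeCont hres⟩

/-- **INDEPENDENTLY, FROM THE SPINE'S U2 ∕ N22 CURRENCY**: history moduli `HistLipschitz Λ γ D.βfun` on a box `γ > 0` (node U2's input;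
NE9-type, NOT PRINTED) give N26's literal — `T4BetaStationary.betaContH_of_histLipschitz` BY NAME (the converse fails). -/
theorem n26_of_histLipschitz (D : FiniteEpsData F G) {Λ : ℕ → ℕ → ℝ} {γ : ℝ} (hγ : 0 < γ)
    (hL : T4CouplingMatching.HistLipschitz Λ γ D.βfun) : ∃ γc : ℝ, 0 < γc ∧ BetaContH γc D.βfun :=
  ⟨γ, hγ, T4BetaStationary.betaContH_of_histLipschitz hL⟩

/-- From the tree's literal β-package at the datum (B3-literal ∧ B4-literal), N26 is the second projection. -/
theorem n26_of_betaPertHyp (D : FiniteEpsData F G) (h : BetaPertHyp D.βfun) :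
    ∃ γc : ℝ, 0 < γc ∧ BetaContH γc D.βfun :=
  h.2

end Datum

section Record

variable {N : ℕ} [NeZero N]

/-- **THE RECORD-PREDICATE SHAPE** (dagwriter UVSplit `N26_B4lit Rec`, verbatim body, for ANY record predicate `Rec` — NODE 00's Stage-5
notion is a parameter, R422): if at every (family, datum, world) of record the rows-(D4) ∧ B4 residue `AtSlopeCont` holds for some split
of the datum's β-family on some box `γ₀ > 0`, then N26 holds at the record. -/
theorem n26_at_record (Rec : ∀ F : T4Family, FiniteEpsData F (Matrix.specialUnitaryGroup (Fin N) ℂ) → WorldP → Prop)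
    (hD4 : ∀ (F : T4Family) (D : FiniteEpsData F (Matrix.specialUnitaryGroup (Fin N) ℂ)) (w : WorldP), Rec F D w →
      ∃ (Sβ : B12Beta.OneLoopSplit D.βfun) (γ₀ s : ℝ), 0 < γ₀ ∧ AtSlopeCont Sβ γ₀ s) :
    ∀ (F : T4Family) (D : FiniteEpsData F (Matrix.specialUnitaryGroup (Fin N) ℂ)) (w : WorldP), Rec F D w →
      ∃ γc : ℝ, 0 < γc ∧ BetaContH γc D.βfun := fun F D w hw => by
  obtain ⟨Sβ, γ₀, s, hγ₀, hres⟩ := hD4 F D w hw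
  exact n26_of_atSlopeCont D Sβ hγ₀ hres

end Record

/-! ## §2 Where N26 sits in item `EndpointGivenB` (stmt-QuantumFields-19181): B4 and B6 close WITH B3 from ONE β-side package

POINTERS (tree, by name; not re-exported): B4 is NOT SPARE for endpoint existence — `Gaps.EndContLetterWitness.not_endpointExistence_betaJ`
(the staircase: (UP) ∕ cooperative ∕ monotone letters WITHOUT continuity give no `EndpointExistence`); and what the END really uses of
B4 is continuity along the one-parameter foliation ∕ on the survivor sets of ONE box (`Gaps.EndContAlongFoliation.
endpointExistence_iff_topRuns_folCont`, `Gaps.EndSurvivorCensus.endpointExistence_iff_topRuns_survCont`). -/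

section Endpoint

variable {F : T4Family} {G : Type*} [GaugeGroup G] [MeasurableSpace G] [HaarData G] {Lc : ℕ} [NeZero Lc]

/-- **N25 ∧ N26 ∧ N28(γ) AT A DATUM FROM ONE β-SIDE PACKAGE**: a one-loop split `Sβ` of `D.βfun` with its one-loop part pinned to the
typed step kernels (`hβ`), row (D1)'s residue `Gaps.D1Residue.Residue Lc Js Nc μ ν`, rows (D4) ∧ B4's residue
`AtSlopeCont Sβ γ₀ (stepBal Nc Lc)` and `0 < γ₀` ⟹ endpoint existence for the datum's construction ([I] Thm 2, first sentence;
`Gaps.BetaContFromD4Chain.endpointExistence_of_residue_atSlopeCont` with forward generation `D.fwd`) AND N26's literal AND the γ-half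
of N28 — the discharge form's «B4 ∕ B6 are consumed inside B3» made kernel-explicit.  Every binder a hypothesis; instance 0∕1. -/
theorem endpoint_and_n26_of_residue_atSlopeCont (D : FiniteEpsData F G) (Sβ : B12Beta.OneLoopSplit D.βfun)
    (Js : ℕ → JetData 3 Lc) {Nc : ℝ} {μ ν : Fin 4} (hβ : ∀ j, Sβ.β0 j = B12Beta.secondMoment (TbalOf Lc Js j) μ ν)
    (h1 : D1Residue.Residue Lc Js Nc μ ν) {γ₀ : ℝ} (hγ₀ : 0 < γ₀)
    (hres : AtSlopeCont Sβ γ₀ (B12Normalization.stepBal Nc Lc)) :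
    EndpointExistence D.C.toB12 ∧ (∃ γc : ℝ, 0 < γc ∧ BetaContH γc D.βfun) ∧ 0 < γ₀ :=
  ⟨endpointExistence_of_residue_atSlopeCont D.fwd Sβ Js hβ h1 hγ₀ hres, ⟨γ₀, hγ₀, betaContH_of_atSlopeCont hres⟩, hγ₀⟩

/-- The same with row (D1) in DRIFT currency `D1Drift Lc Js Nc μ ν` (`Gaps.BetaContFromD4Chain.endpointExistence_of_D1Drift_atSlopeCont`). -/
theorem endpoint_and_n26_of_D1Drift_atSlopeCont (D : FiniteEpsData F G) (Sβ : B12Beta.OneLoopSplit D.βfun)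
    (Js : ℕ → JetData 3 Lc) {Nc : ℝ} {μ ν : Fin 4} (hβ : ∀ j, Sβ.β0 j = B12Beta.secondMoment (TbalOf Lc Js j) μ ν)
    (hD : D1Drift Lc Js Nc μ ν) {γ₀ : ℝ} (hγ₀ : 0 < γ₀) (hres : AtSlopeCont Sβ γ₀ (B12Normalization.stepBal Nc Lc)) :
    EndpointExistence D.C.toB12 ∧ (∃ γc : ℝ, 0 < γc ∧ BetaContH γc D.βfun) ∧ 0 < γ₀ :=
  ⟨endpointExistence_of_D1Drift_atSlopeCont D.fwd Sβ Js hβ hD hγ₀ hres, ⟨γ₀, hγ₀, betaContH_of_atSlopeCont hres⟩, hγ₀⟩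

/-- Generic `d`, raw-chain currency: a one-loop DRIFT `OneLoopDrift b A Sβ.β0` + ONE chain + side conditions + smallness `ε₁·K_rem,L ≤ b`
+ `CPt` + `0 < γ` ⟹ endpoint existence AND N26's literal (`endpointExistence_of_drift_chainTFac190H_cpt` ∕ §1). -/
theorem endpoint_and_n26_of_drift_chainTFac190H (D : FiniteEpsData F G) {d M : ℕ} [NeZero M] (hd : 0 < d)
    {μ ν : Fin d} (Sβ : B12Beta.OneLoopSplit D.βfun) {γ : ℝ} (hγ : 0 < γ) {c : B13.Consts} {ℓ α₂ : ℝ}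
    {q : Consts190} (R : ChainTFac190H d M μ ν Sβ γ c ℓ α₂ q) (hC : CondsL d c ℓ) (h22 : c.R22gen ℓ)
    (hq : q.Valid c.δ₀) (hs : SignsL c α₂ q.B₃) {b A : ℝ} (hdrift : Beta.Drift.OneLoopDrift b A Sβ.β0)
    (hε₁ : c.ε₁ * remCoeffL d M c α₂ q.B₃ ≤ b) (hcont : CPt R) :
    EndpointExistence D.C.toB12 ∧ ∃ γc : ℝ, 0 < γc ∧ BetaContH γc D.βfun :=
  ⟨endpointExistence_of_drift_chainTFac190H_cpt D.fwd R hC h22 hq hs hd hγ hdrift hε₁ hcont,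
    γ, hγ, betaContH_of_chainTFac190H R hC h22 hq hs hd hcont⟩

end Endpoint

section Item

/-- **ITEM `EndpointGivenB` ⇐ THE β-SIDE PACKAGE OF RECORD AT EVERY STAGE-0 DATUM OF RECORD CARRYING (B)** (SU(2); the glue of NODE O's
β-side for stmt-QuantumFields-19181 with the children as ONE declared hypothesis `hβ`): if for every four-torus family and every finite-ε
SU(2) datum with NODE 00's averaging of record (`Node00.IsDatumOfRecord₀`), (B) pinned and runs in every small window, SOME one-loop
split of `D.βfun` pinned to the step kernels carries row (D1)'s residue and rows (D4) ∧ B4's residue `AtSlopeCont` at the one-loop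
slope `stepBal 2 Lc` on a box `γ₀ > 0`, then `Theses.BalabanUVNodes.EndpointGivenB` — with the SAME datum as witness
(`endpointExistence_of_residue_atSlopeCont`, forward generation `D.fwd`).  `hβ` is NOT a theorem (NODE O: instance 0∕1); this is
bookkeeping, not a discharge. -/
theorem endpointGivenB_of_betaSide
    (hβ : ∀ (F : T4Family) (D : FiniteEpsData F (Matrix.specialUnitaryGroup (Fin 2) ℂ)),
      Node00.IsDatumOfRecord₀ F 2 D → B16.EndStatementBPrinted D.C →
      (∃ γ₁ : ℝ, 0 < γ₁ ∧ ∀ γ : ℝ, 0 < γ → γ ≤ γ₁ → ∃ P : B12.RunParams, (D.C P).flow.InInterval γ P.K) →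
      ∃ (Lc : ℕ) (_ : NeZero Lc) (Sβ : B12Beta.OneLoopSplit D.βfun) (Js : ℕ → JetData 3 Lc) (μ ν : Fin 4) (γ₀ : ℝ),
        (∀ j, Sβ.β0 j = B12Beta.secondMoment (TbalOf Lc Js j) μ ν) ∧ D1Residue.Residue Lc Js (2 : ℝ) μ ν ∧ 0 < γ₀ ∧
          AtSlopeCont Sβ γ₀ (B12Normalization.stepBal (2 : ℝ) Lc)) :
    Summit.QuantumFields.YangMills.Theses.BalabanUVNodes.EndpointGivenB := by
  intro F hF
  obtain ⟨D, hrec, hB, hwin⟩ := hF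
  obtain ⟨Lc, _, Sβ, Js, μ, ν, γ₀, hβ0, h1, hγ₀, hres⟩ := hβ F D hrec hB hwin
  exact ⟨D, hrec, hB, endpointExistence_of_residue_atSlopeCont D.fwd Sβ Js hβ0 h1 hγ₀ hres⟩

/-- **THE SAME THROUGH THE LITERAL BINDERS B3 ∧ B4** (`T4Continuum.BetaPertHyp D.βfun` = `(∃ β̄ > 0, BetaPertH D.βfun β̄) ∧ N26-literal`,
`T4Continuum.endpointExistence_of_betaPertHyp` with `D.fwd`): the road on which N26 is NOT vacated.  RECORDED, NOT RECOMMENDED: the tree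
flags `BetaPertH` RIGID (`BetaPertRigid.not_betaPertH_of_two_scales`, presumably false for Bałaban's family); the road of record is
`endpointGivenB_of_betaSide`. -/
theorem endpointGivenB_of_betaPertHyp
    (hβ : ∀ (F : T4Family) (D : FiniteEpsData F (Matrix.specialUnitaryGroup (Fin 2) ℂ)),
      Node00.IsDatumOfRecord₀ F 2 D → B16.EndStatementBPrinted D.C →
      (∃ γ₁ : ℝ, 0 < γ₁ ∧ ∀ γ : ℝ, 0 < γ → γ ≤ γ₁ → ∃ P : B12.RunParams, (D.C P).flow.InInterval γ P.K) →
      BetaPertHyp D.βfun) :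
    Summit.QuantumFields.YangMills.Theses.BalabanUVNodes.EndpointGivenB := by
  intro F hF
  obtain ⟨D, hrec, hB, hwin⟩ := hF
  exact ⟨D, hrec, hB, endpointExistence_of_betaPertHyp D.C.toB12 D.βfun (hβ F D hrec hB hwin) D.fwd⟩

end Item

/-! ## §3 The LITERAL T⁴ headline with its B4 binder supplied by the (D4) chain + `CPt` -/

section Headline

variable {F : T4Family} {N : ℕ} [NeZero N]

/-- **`continuumYM4_torus_of_BetaPertH_nonvacuous` WITH B4 FROM THE CHAIN**: a printed-averaged datum on `SU(N)`, (B), the literal B3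
`BetaPertH D.βfun β̄` with `0 < β̄`, ONE (D4)-chain instance for a split of `D.βfun` on the box `γ₀ > 0` with side conditions and `CPt`
(in place of the binders `hγc`, `hC`), and the spine slot under the literal β-package ⟹ `ContinuumYM4Torus D ∧ ContinuumYM4TorusE D`.
B1, B2, B3, B5 stay binders; finite four-torus; NOT ℝ⁴, NOT a mass gap. -/
theorem continuumYM4Torus_of_BetaPertH_chain (D : FiniteEpsData F (Matrix.specialUnitaryGroup (Fin N) ℂ))
    (hD : D.IsPrintedAveraged) (hB : B16.EndStatementBPrinted D.C) {βbar : ℝ} (hβbar : 0 < βbar)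
    (hP : BetaPertH D.βfun βbar) {M : ℕ} [NeZero M] {μ ν : Fin 4} (Sβ : B12Beta.OneLoopSplit D.βfun) {γ₀ : ℝ}
    (hγ₀ : 0 < γ₀) {c : B13.Consts} {ℓ α₂ : ℝ} {q : Consts190} (R : ChainTFac190H 4 M μ ν Sβ γ₀ c ℓ α₂ q)
    (hC : CondsL 4 c ℓ) (h22 : c.R22gen ℓ) (hq : q.Valid c.δ₀) (hs : SignsL c α₂ q.B₃) (hcont : CPt R)
    (hNE : T4ApexHybrid.HybridNE7Under D (BetaPertHyp D.βfun)) : ContinuumYM4Torus D ∧ ContinuumYM4TorusE D :=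
  continuumYM4_torus_of_BetaPertH_nonvacuous D hD hB hβbar hP hγ₀
    (betaContH_of_chainTFac190H R hC h22 hq hs (by norm_num) hcont) hNE

end Headline

/-! ## §4 Satisfiability of the hypothesis list AT a Stage-0 datum of record (placeholder; NOT an instance for Bałaban's β) -/

section Satisfiable

/-- **THE HYPOTHESES OF §1–§2 ARE JOINTLY SATISFIABLE AT A STAGE-0 DATUM OF RECORD** — audit A1–A6 only: the tree's placeholder datum
`T4FiniteEpsInhabited.stubData` realised on NODE 00's averaging of record `Node00.avOfRecord F N` IS a Stage-0 datum of record
(`IsDatumOfRecord₀` by `rfl`), its β-family is `≡ 0`, and the zero remainder chain (`RemainderWitness.zeroLeaves190` at the records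
`c₀ 4`, `ℓ = 2`, `α₂ = 1`, `q₀`) gives `AtSlopeCont` for the split `0 = 0 + 0` on EVERY box, with `CPt` trivially (history-free kernel).
HONESTY LABEL (dag-ref-D l.8905): this is the WRONG β for Bałaban — (B) is FALSE at this datum (second conjunct,
`not_endStatementBPrinted_of_stubData`), so NO discharge reads through it; the instance count for Bałaban's split stays 0∕1. -/
theorem hypotheses_satisfiable_placeholder (F : T4Family) (N : ℕ) [NeZero N] (M : ℕ) [NeZero M] (γ₀ : ℝ) :
    ∃ D : FiniteEpsData F (Matrix.specialUnitaryGroup (Fin N) ℂ), Node00.IsDatumOfRecord₀ F N D ∧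
      ¬ B16.EndStatementBPrinted D.C ∧
      ∃ Sβ : B12Beta.OneLoopSplit D.βfun, AtSlopeCont Sβ γ₀ ((c₀ 4).ε₁ * remCoeffL 4 M (c₀ 4) 1 q₀.B₃) := by
  refine ⟨T4FiniteEpsInhabited.stubData F (Matrix.specialUnitaryGroup (Fin N) ℂ) (Node00.avOfRecord F N)
      (Node00.avOfRecord_measurable F N) (Node00.avOfRecord_haarAC F N), rfl,
    T4FiniteEpsInhabited.not_endStatementBPrinted_of_stubData F _ _ _ _, ?_⟩
  have hA : 0 ≤ (c₀ 4).C3act * (c₀ 4).ε₁ := (c₀_activity_pos 4).le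
  let S0 : B12Beta.OneLoopSplit T4FiniteEpsInhabited.zeroHBeta :=
    { β0 := fun _ => 0
      β1 := fun _ _ => 0
      split := fun _ _ => by simp [T4FiniteEpsInhabited.zeroHBeta]
      vanish := fun _ _ _ => rfl }
  let R : ChainTFac190 4 M 0 1 S0 γ₀ (c₀ 4) 2 1 q₀ :=
    { A1 := fun _ _ _ _ => 0
      beta1_eq := fun _ _ _ => by
        show (0 : ℝ) = B12Beta.secondMoment (fun _ _ => limKernel (fun (_ : LDom 4) (_ : B13ScaleTransfer.Pt 4) => (0 : ℝ))) 0 1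
        simp [B12Beta.secondMoment, limKernel]
      leaves := fun _ _ _ => zeroLeaves190 4 M (c₀ 4) 2 1 hA }
  refine ⟨S0, atSlopeCont_of_chainTFac190 R (c₀_condsL 4) (c₀_R22gen 4) (q₀_valid_c₀ 4)
    ((q₀_valid_c₀ 4).signsL hA one_pos D4Residue.c₀_four_δ₀_pos) le_rfl fun k x => ?_⟩
  show ContinuousOn (fun _ : Fin (k + 1) → ℝ => limKernel (fun (_ : LDom 4) (_ : B13ScaleTransfer.Pt 4) => (0 : ℝ)) x) (Box γ₀ k)
  exact continuousOn_const

end Satisfiable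

/-! ## §5 (v1.1 — answer to dag-ref-D's DISCHARGE READ #7, question A3, pub-ymgap INBOX l.9156) The β-side package of §2 is
UNSATISFIABLE at the flat datum, so the ∀-form item glue is true-but-vacuous at Stage 0; the ∃-form is the surviving shape

WHY (kernel, below): `split` + `vanish` ([I] (2.14)) give `Sβ.β0 k = β k 0` for EVERY split; for the FLAT family `β ≡ 0` (the junk datum
of p409380 ∕ p409394) `β0 ≡ 0`, which admits no drift of positive slope, hence neither `D1Drift` nor `D1Residue.Residue` once the split
is pinned — for `Lc ≥ 2`, `Nc > 0` (`stepBal_pos`; `Lc = 1`, slope 0, is outside Bałaban's L odd > 11).  So `hβ` of `endpointGivenB_of_betaSide`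
cannot be met with `Lc ≥ 2` at a flat Stage-0 record datum; the per-datum §2 theorem and the ∃-form below are the non-vacuous shapes. -/

section Flat

/-- **For every one-loop split `Sβ.β0 k = β k 0`** (`split` at the zero history + `vanish`, the printed remark (2.14)). -/
theorem oneLoopSplit_β0_eq {β : HBeta} (Sβ : B12Beta.OneLoopSplit β) (k : ℕ) : Sβ.β0 k = β k (fun _ => 0) := by
  have h1 := Sβ.split k (fun _ => 0)
  rw [Sβ.vanish k (fun _ => 0) rfl, add_zero] at h1
  exact h1.symm

/-- Hence EVERY split of the flat family `β ≡ 0` has vanishing one-loop coefficients `β0 ≡ 0`. -/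
theorem β0_eq_zero_of_flat (Sβ : B12Beta.OneLoopSplit (fun _ _ => (0 : ℝ))) (k : ℕ) : Sβ.β0 k = 0 :=
  oneLoopSplit_β0_eq Sβ k

/-- The zero coefficient sequence has NO one-loop drift of positive slope (`|0 − b·k| ≤ A` fails for `k > A ∕ b`). -/
theorem not_oneLoopDrift_zero {b A : ℝ} (hb : 0 < b) : ¬ Beta.Drift.OneLoopDrift b A (fun _ => 0) := by
  intro h
  obtain ⟨k, hk⟩ := exists_nat_gt (A / b)
  have hk' : A < b * k := by
    have := (div_lt_iff₀ hb).1 hk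
    linarith [mul_comm b (k : ℝ)]
  have h' := h k
  simp only [Finset.sum_const_zero, zero_sub, abs_neg] at h'
  rw [abs_of_nonneg (by positivity)] at h'
  linarith

/-- **No (D1) drift at the flat datum**: a pinned split of `β ≡ 0` has `β0 ≡ 0`, so `D1Drift Lc Js Nc μ ν` fails (`Lc ≥ 2`, `Nc > 0`). -/
theorem not_d1Drift_of_split_flat {Lc : ℕ} [NeZero Lc] (hLc : 2 ≤ Lc) (Sβ : B12Beta.OneLoopSplit (fun _ _ => (0 : ℝ)))
    (Js : ℕ → JetData 3 Lc) {Nc : ℝ} (hN : 0 < Nc) {μ ν : Fin 4}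
    (hβ : ∀ j, Sβ.β0 j = B12Beta.secondMoment (TbalOf Lc Js j) μ ν) : ¬ D1Drift Lc Js Nc μ ν := by
  rintro ⟨A, hA⟩
  have h0 : (fun j => B12Beta.secondMoment (TbalOf Lc Js j) μ ν) = fun _ => 0 :=
    funext fun j => by rw [← hβ j, β0_eq_zero_of_flat]
  rw [h0] at hA
  exact not_oneLoopDrift_zero (B12Normalization.stepBal_pos hN (by exact_mod_cast hLc)) hA

/-- Hence no (D1) RESIDUE at the flat datum either (`Gaps.D1Residue.d1Drift_of_residue`). -/
theorem not_residue_of_split_flat {Lc : ℕ} [NeZero Lc] (hLc : 2 ≤ Lc) (Sβ : B12Beta.OneLoopSplit (fun _ _ => (0 : ℝ)))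
    (Js : ℕ → JetData 3 Lc) {Nc : ℝ} (hN : 0 < Nc) {μ ν : Fin 4}
    (hβ : ∀ j, Sβ.β0 j = B12Beta.secondMoment (TbalOf Lc Js j) μ ν) : ¬ D1Residue.Residue Lc Js Nc μ ν :=
  fun h => not_d1Drift_of_split_flat hLc Sβ Js hN hβ (D1Residue.d1Drift_of_residue Js h)

/-- **A3 ANSWERED (kernel)**: for the flat β-family, NO pinned split carries row (D1)'s residue (`Lc ≥ 2`, `Nc > 0`) — the §2 package
is unsatisfiable there before rows (D4) ∧ B4 are even asked. -/
theorem betaSidePackage_unsat_flat {Lc : ℕ} [NeZero Lc] (hLc : 2 ≤ Lc) {Nc : ℝ} (hN : 0 < Nc) :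
    ¬ ∃ (Sβ : B12Beta.OneLoopSplit (fun _ _ => (0 : ℝ))) (Js : ℕ → JetData 3 Lc) (μ ν : Fin 4),
        (∀ j, Sβ.β0 j = B12Beta.secondMoment (TbalOf Lc Js j) μ ν) ∧ D1Residue.Residue Lc Js Nc μ ν := by
  rintro ⟨Sβ, Js, μ, ν, hβ, h⟩
  exact not_residue_of_split_flat hLc Sβ Js hN hβ h

end Flat

section ItemExists

/-- **THE ∃-FORM (non-vacuous antecedent)**: ONE Stage-0 datum of record per family with (B) AND its β-side package (pinned split,
(D1) residue, `AtSlopeCont` at the one-loop slope, `0 < γ₀`) ⟹ item 19181's CONCLUSION CLAUSE at that datum (stated literally). -/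
theorem endpoint_conclusion_of_exists_betaSide
    (hβ : ∀ F : T4Family, ∃ D : FiniteEpsData F (Matrix.specialUnitaryGroup (Fin 2) ℂ),
      Node00.IsDatumOfRecord₀ F 2 D ∧ B16.EndStatementBPrinted D.C ∧
      ∃ (Lc : ℕ) (_ : NeZero Lc) (Sβ : B12Beta.OneLoopSplit D.βfun) (Js : ℕ → JetData 3 Lc) (μ ν : Fin 4) (γ₀ : ℝ),
        (∀ j, Sβ.β0 j = B12Beta.secondMoment (TbalOf Lc Js j) μ ν) ∧ D1Residue.Residue Lc Js (2 : ℝ) μ ν ∧ 0 < γ₀ ∧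
          AtSlopeCont Sβ γ₀ (B12Normalization.stepBal (2 : ℝ) Lc))
    (F : T4Family) :
    ∃ D : FiniteEpsData F (Matrix.specialUnitaryGroup (Fin 2) ℂ), Node00.IsDatumOfRecord₀ F 2 D ∧
      B16.EndStatementBPrinted D.C ∧ EndpointExistence D.C.toB12 := by
  obtain ⟨D, hrec, hB, Lc, _, Sβ, Js, μ, ν, γ₀, hβ0, h1, hγ₀, hres⟩ := hβ F
  exact ⟨D, hrec, hB, endpointExistence_of_residue_atSlopeCont D.fwd Sβ Js hβ0 h1 hγ₀ hres⟩

/-- The same concluding `Theses.BalabanUVNodes.EndpointGivenB` (rev 0) BY NAME (its antecedent unused: the package brings its own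
datum).  Conditional glue; credits nothing; NOT a proof of the item (director LINE №16 (1) ∕ chair R432 (B)(1)). -/
theorem endpointGivenB_of_exists_betaSide
    (hβ : ∀ F : T4Family, ∃ D : FiniteEpsData F (Matrix.specialUnitaryGroup (Fin 2) ℂ),
      Node00.IsDatumOfRecord₀ F 2 D ∧ B16.EndStatementBPrinted D.C ∧
      ∃ (Lc : ℕ) (_ : NeZero Lc) (Sβ : B12Beta.OneLoopSplit D.βfun) (Js : ℕ → JetData 3 Lc) (μ ν : Fin 4) (γ₀ : ℝ),
        (∀ j, Sβ.β0 j = B12Beta.secondMoment (TbalOf Lc Js j) μ ν) ∧ D1Residue.Residue Lc Js (2 : ℝ) μ ν ∧ 0 < γ₀ ∧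
          AtSlopeCont Sβ γ₀ (B12Normalization.stepBal (2 : ℝ) Lc)) :
    Summit.QuantumFields.YangMills.Theses.BalabanUVNodes.EndpointGivenB :=
  fun F _ => endpoint_conclusion_of_exists_betaSide hβ F

end ItemExists

end Summit.QuantumFields.YangMills.Theorems.BalabanUVNodesN26

end
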